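import Summits.BirchSwinnertonDyer.Rank1Residual.X11b.BDPRouteDescent
import HarnessLib

/-!
# The Heegner-index descent `K → ℚ` at an odd prime WITH the parametrisation constant carried
# (Gross–Zagier V.(2.2) / Castella–Grossi–Lee–Skinner (5.5) shape): the Manin constant is NOT
# assumed prime to `p`

HONEST FRAMING (cell `bsd-cm`, run/shared/lean/pub/bsd-cm/, verbatim): the programme isolates, for
CM elliptic curves over `ℚ` of analytic rank `≤ 1`, classes on which the FULL BSD formula is
reduced — strictly by PUBLISHED theorems entering as named-fact binders — to ONE local problem at
ONE prime, and then TYPES that residual problem. Seat `bsd-cm-ram` (generation 2). THEOREMS ONLY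
(no definition, no named fact): a one-hypothesis generalisation of the tree's PROVED
`X11b.bsdp_of_indexIdentityAt` (`Summits/…/X11b/BDPRouteDescent.lean`), needed by ROUTE U of the
seat's memo `HOME/bsd-cm-ram/ROUTE-U.md` (§5–§6: "the constant `c_Φ` CANCELS"), and its Route-U
corollary. There the identity over `K` is the MANIN-FREE `X11b.IndexIdentityAt`, usable only under
`p ∤ c` (`c = Dt.c`, `Φ^*ω_𝓔 = c·2πi f(τ)dτ`). Here the identity carries `c`:
  (†) `2·ord_p ∏_ℓ c_ℓ(E/ℚ) + ord_p #Ш(E/K) + 2·ord_p c = 2·ord_p [E(K) : ℤ·P]`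
— the `p`-adic valuation of Gross–Zagier's Conjecture V.(2.2) / Gross 1991 (2.2) for an all-split `K`,
printed WITH the Manin constant as display (5.5) of Castella–Grossi–Lee–Skinner 2022 (tree
`CastellaGrossiLeeSkinner2022.display55_sha_heegnerIndex`) — and `p ∤ c` is weakened to `c ≠ 0`.
The proof is the tree's proof VERBATIM (Gross–Zagier `gross_zagier`, whose constant
`2·covol/(c²(w/2)²√|d_K|)` carries `c²`; Kolyvagin; GZK; modularity; the twist's rank-`0` `p`-part
in print shape; Artin formalism; period relation; height–index relation; odd parts of `Ш` and
torsion under quadratic base change) with `ord_p c` kept in the final count: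
`#Ш_an(E) = 8 I² t_W² / (n m t_K² c² w² q_d |u| c_W)`, `ord_p #Ш_an = 2·ord_p I − 2·ord_p c − ord_p q_d
+ units = ord_p #Ш(E/ℚ)` by (†). WHY (memo §6): when the index is controlled through a `p`-adic
LOGARITHM in `ω_f = ω_𝓔/c` (Kriz–Li 2019 Thm. 7.1), one gets `ord_p [E(K):ℤP] = ord_p c`, and (†) —
not the Manin-free identity — is what holds; the constant cancels (`bsdp_of_heegnerIndexVal_eq_maninVal`).
Refs: [GrossZagier1986] V.§2; [CastellaGrossiLeeSkinner2022] (5.5); [JetchevSkinnerWan2017] §7.4.1; [KrizLi2019] §10.3. -/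

noncomputable section

open scoped Classical

open WeierstrassCurve NumberField Literature.NumberTheory.EllipticCurves
  Literature.NumberTheory.EllipticCurves.ModularForms
  Literature.NumberTheory.EllipticCurves.Rank1Residual
  Literature.NumberTheory.EllipticCurves.KrizLi2019
  Literature.NumberTheory.QuadraticFields
  Summit.BirchSwinnertonDyer.Rank1Residual.X11b

namespace Summit.BirchSwinnertonDyer.Rank1Residual.X12.O11

/-- **`BSD(E,p)` over `ℚ` from the Heegner-index identity (†) over `K` WITH the parametrisation
constant, Gross–Zagier, Kolyvagin and the rank-zero `p`-part of the twist** — Jetchev–Skinner–Wan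
2017 §7.4.1 / Gross–Zagier 1986 V.§2, EXACT at an odd prime `p`; hypothesis (†) (granted finiteness of
`Ш(E/K)`) replaces `X11b.IndexIdentityAt` + `p ∤ c`, and `c ≠ 0` replaces `p ∤ c`; all other data
and PUBLISHED binders exactly as in `X11b.bsdp_of_indexIdentityAt` (whose proof this is, with
`ord_p c` kept). CONCLUSION: `BSDp W p`. [cite: GrossZagier1986, V.§2 (pp. 310–312)]
[cite: CastellaGrossiLeeSkinner2022, display (5.5) (proof of Thm. 5.3.1)]
[cite: JetchevSkinnerWan2017, §7.4.1 (eq:gz for K′), p. 30] [cite: Miller2011LMS, Def. 1.1] -/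
theorem bsdp_of_indexIdentityManin
    (W : WeierstrassCurve ℚ) [W.IsElliptic] [W.IsGloballyMinimal] (p : ℕ) [Fact p.Prime]
    (N : ℕ) [NeZero N] (K : Type) [Field K] [NumberField K]
    (Dt : ModularParametrizationData W N) (H : HeegnerDatum N (NumberField.discr K)) (ι : K →+* ℂ)
    (P : (W.baseChange K).toAffine.Point)
    -- the published inputs (named facts of the tree)
    (hGZ : gross_zagier N W K) (hKo : kolyvagin N W K)
    (hGZK : rank_eq_analyticRank_of_analyticRank_le_one) (hmod : hasEntireLFunction_rat)
    -- the data
    (hK : IsImaginaryQuadratic K) (hHN : SatisfiesHeegnerHypothesis N K)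
    (hP : WeierstrassCurve.Affine.Point.map ι.toRatAlgHom P = heegnerPointComplex Dt H)
    (hp2 : p ≠ 2) (hc0 : Dt.c ≠ 0) (hμ : ¬ p ∣ Units.torsionOrder K)
    (hr : W.analyticRank = 1)
    (hLt : (W.quadraticTwist (NumberField.discr K : ℚ)).entireLFunction 1 ≠ 0)
    -- a globally minimal model of the quadratic twist by `d_K`
    (Wd : WeierstrassCurve ℚ) [Wd.IsElliptic] [Wd.IsGloballyMinimal] (Cd : VariableChange ℚ)
    (hWd : Cd • W.quadraticTwist (NumberField.discr K : ℚ) = Wd)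
    -- the rank-zero `p`-part of the twist, print shape of bsd.S30 / Skinner 2016 Thm. C
    (htw : ∃ q : ℚ, Wd.entireLFunction 1 / (Wd.realPeriodRat : ℂ) = (q : ℂ) ∧
      padicValRat p q = (padicValNat p Wd.shaOrder : ℤ) + padicValNat p Wd.tamagawaProduct -
        2 * padicValNat p Wd.torsionOrder)
    -- the two decidable side conditions
    (htam : padicValNat p Wd.tamagawaProduct = padicValNat p W.tamagawaProduct)
    (hu : padicValRat p (Cd.u : ℚ) = 0)
    -- the identity over `K`, WITH the constant of the parametrisation (GZ86 V.(2.2) / CGLS (5.5) shape)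
    (hid : Finite (W.baseChange K).sha →
      2 * padicValNat p W.tamagawaProduct + padicValNat p (W.baseChange K).shaOrder +
          2 * padicValInt p Dt.c = 2 * padicValNat p (AddSubgroup.zmultiples P).index) :
    BSDp W p := by
  have hpp : p.Prime := Fact.out
  haveI hEK : (W.baseChange K).IsElliptic := isElliptic_baseChange' W K
  obtain ⟨h2, hKtc⟩ := hK
  haveI : IsTotallyComplex K := hKtc
  have hD0 : (NumberField.discr K : ℚ) ≠ 0 := by exact_mod_cast NumberField.discr_ne_zero K
  haveI hEt : (W.quadraticTwist (NumberField.discr K : ℚ)).IsElliptic :=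
    W.isElliptic_quadraticTwist hD0
  ---------------------------------------------------------------- `L`-values over `ℚ` and `K`
  have hL0 : W.entireLFunction 1 = 0 := entireLFunction_one_eq_zero_of_analyticRank_eq_one hr
  obtain ⟨hlead, hderiv⟩ := leadingLCoeff_eq_deriv_of_analyticRank_eq_one hr
  have hprod := lDerivEK_eq_deriv_mul W K hmod hL0
  have hLK : LDerivEK W K ≠ 0 := by
    rw [hprod]; exact mul_ne_zero hderiv hLt
  ---------------------------------------------------------------- the Heegner point is non-torsion; Kolyvagin
  have hPH : IsHeegnerPoint N W K P := ⟨Dt, H, ι, hP⟩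
  have hPinf : ¬ IsOfFinAddOrder P :=
    (lDerivEK_ne_zero_iff_not_isOfFinAddOrder W N K hGZ ⟨h2, hKtc⟩ hHN hPH).mp hLK
  obtain ⟨hrkK, hShaK⟩ := hKo ⟨h2, hKtc⟩ hHN hPH hPinf
  haveI hfinK : Finite (W.baseChange K).sha := hShaK
  have hKL := hid hfinK
  have hShaW : W.ShaFinite := Literature.NumberTheory.EllipticCurves.shaFinite_of_baseChange W K hShaK
  haveI hfinW : Finite W.sha := hShaW
  ---------------------------------------------------------------- analytic ranks
  have hrt : (W.quadraticTwist (NumberField.discr K : ℚ)).analyticRank = 0 :=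
    ((W.quadraticTwist _).analyticRank_eq_zero_iff_holds (hmod _)).2 hLt
  have hrd : Wd.analyticRank = 0 := by rw [← hWd, analyticRank_smul, hrt]
  ---------------------------------------------------------------- Gross–Zagier–Kolyvagin for `W` and `Wd`
  have hr1 : W.analyticRank ≤ 1 := le_of_eq hr
  have hrQ : W.mordellWeilRank = 1 := by rw [(hGZK W hr1).1, hr]
  have hrd1 : Wd.analyticRank ≤ 1 := by omega
  obtain ⟨hrankd, hShad⟩ := hGZK Wd hrd1
  have hrkd : Wd.mordellWeilRank = 0 := by rw [hrankd, hrd]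
  haveI hfind : Finite Wd.toAffine.Point := Wd.mordellWeilRank_eq_zero_iff_holds.mp hrkd
  haveI hfinSd : Finite Wd.sha := hShad
  have htdeq : Wd.torsionOrder = Nat.card Wd.toAffine.Point := Wd.torsionOrder_eq_natCard_of_finite
  ---------------------------------------------------------------- heights and index (Kriz–Li §2)
  obtain ⟨m, hm, hheight⟩ :=
    exists_mul_canonicalHeight_eq_index_sq_mul_regulator W K h2 hrkK hrQ P hPinf
  ---------------------------------------------------------------- Gross–Zagier and the period
  have hLD := (hGZ ⟨h2, hKtc⟩ hHN) Dt H ι P hP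
  have hper := two_mul_covolume_div_sqrt_eq_bsdPeriod W K Dt h2
  have hΩ := W.realPeriod_mul_realPeriod_quadraticTwist_eq_mul_bsdPeriod K h2
  have hΩd : Wd.realPeriodRat =
      |((Cd.u : ℚ) : ℝ)| * (W.quadraticTwist (NumberField.discr K : ℚ)).realPeriodRat := by
    rw [← hWd]; exact realPeriodRat_smul_holds (W.quadraticTwist _) Cd
  have hLt' : (W.quadraticTwist (NumberField.discr K : ℚ)).entireLFunction = Wd.entireLFunction := by
    rw [← hWd, entireLFunction_smul]
  ---------------------------------------------------------------- the twist's `L`-value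
  obtain ⟨qd, hqd, hvqd⟩ := htw
  have hΩdpos : 0 < Wd.realPeriodRat := Wd.realPeriodRat_pos_holds
  have hΩdC : (Wd.realPeriodRat : ℂ) ≠ 0 := by exact_mod_cast hΩdpos.ne'
  have hLd : Wd.entireLFunction 1 = (((qd : ℝ) * Wd.realPeriodRat : ℝ) : ℂ) := by
    have := (div_eq_iff hΩdC).mp hqd
    rw [this]; push_cast; ring
  have hLd1 : Wd.entireLFunction 1 ≠ 0 := by rw [← hLt']; exact hLt
  have hqd0 : qd ≠ 0 := by
    intro h0
    apply hLd1
    rw [hLd, h0]; simp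
  ---------------------------------------------------------------- positivity of everything
  have hΩW : 0 < W.realPeriodRat := W.realPeriodRat_pos_holds
  have hΩt : 0 < (W.quadraticTwist (NumberField.discr K : ℚ)).realPeriodRat :=
    (W.quadraticTwist _).realPeriodRat_pos_holds
  have hR : 0 < W.regulator := W.regulator_pos'
  have hcW : 0 < W.tamagawaProduct := W.tamagawaProduct_pos_holds
  have hcd : 0 < Wd.tamagawaProduct := Wd.tamagawaProduct_pos_holds
  have htW : 0 < W.torsionOrder := W.torsionOrder_pos_holds
  have htK : 0 < (W.baseChange K).torsionOrder := (W.baseChange K).torsionOrder_pos_holds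
  have htd : 0 < Nat.card Wd.toAffine.Point := Nat.card_pos
  have hSd : 0 < Wd.shaOrder := Wd.shaOrder_pos hShad
  have hcM : (Dt.c : ℚ) ≠ 0 := by exact_mod_cast hc0
  have hw : 0 < Units.torsionOrder K := Units.torsionOrder_pos K
  have huu : (Cd.u : ℚ) ≠ 0 := Cd.u.ne_zero
  have hm0 : 0 < m := by rcases hm with rfl | rfl <;> norm_num
  have hI0 : (AddSubgroup.zmultiples P).index ≠ 0 := by
    intro hI
    rw [hI] at hheight
    have h0 : (m : ℝ) * ((W.baseChange K).torsionOrder : ℝ) ^ 2 * P.canonicalHeight = 0 := by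
      rw [hheight]; simp
    have hh0 : P.canonicalHeight = 0 := by
      rcases mul_eq_zero.mp h0 with h' | h'
      · rcases mul_eq_zero.mp h' with h'' | h''
        · exact absurd (by exact_mod_cast h'' : m = 0) hm0.ne'
        · exact absurd (pow_eq_zero_iff two_ne_zero |>.mp h'') (by exact_mod_cast htK.ne')
      · exact h'
    exact hPinf ((Affine.Point.canonicalHeight_eq_zero_iff_holds P).mp hh0)
  set n := (W.baseChange ℝ).numRealComponents with hn_def
  have hn : n = 1 ∨ n = 2 := numRealComponents_eq_one_or W
  have hn0 : 0 < n := by rcases hn with h' | h' <;> omega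
  ---------------------------------------------------------------- the rational number `q = #Ш_an`
  set I := (AddSubgroup.zmultiples P).index with hI_def
  set q : ℚ := 8 * (I : ℚ) ^ 2 * (W.torsionOrder : ℚ) ^ 2 /
      ((n : ℚ) * (m : ℚ) * ((W.baseChange K).torsionOrder : ℚ) ^ 2 * (Dt.c : ℚ) ^ 2 *
        (Units.torsionOrder K : ℚ) ^ 2 * qd * |(Cd.u : ℚ)| * (W.tamagawaProduct : ℚ)) with hq_def
  ---------------------------------------------------------------- real abbreviations
  set ΩW := W.realPeriodRat with hΩW_def
  set Ωt := (W.quadraticTwist (NumberField.discr K : ℚ)).realPeriodRat with hΩt_def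
  set B := (W.baseChange K).bsdPeriod with hB_def
  set R := W.regulator with hR_def
  set hh := P.canonicalHeight with hhh_def
  set tK := (W.baseChange K).torsionOrder with htK_def
  set tW := W.torsionOrder with htW_def
  set td := Nat.card Wd.toAffine.Point with htd_def
  set Sd := Wd.shaOrder with hSd_def
  set cdd := Wd.tamagawaProduct with hcdd_def
  set cW := W.tamagawaProduct with hcW_def
  set w := Units.torsionOrder K with hw_def
  set cM := Dt.c with hcM_def
  set u := (Cd.u : ℚ) with hu_def
  have hΩW' : ΩW = (W.baseChange ℝ).realPeriod := rfl
  have hΩt' : Ωt = ((W.quadraticTwist (NumberField.discr K : ℚ)).baseChange ℝ).realPeriod := rfl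
  rw [← hΩW', ← hΩt'] at hΩ
  -- `B = ΩW Ωt / n`, `ĥ = 2 I² R / (m tK²)`, the Gross–Zagier constant `= 4 B / (c² w²)`
  have hBeq : B = ΩW * Ωt / n := by
    rw [hΩ]; field_simp
  have hheq : hh = 2 * (I : ℝ) ^ 2 * R / ((m : ℝ) * (tK : ℝ) ^ 2) := by
    rw [← hheight]; field_simp
  have hGZc : 2 * ZLattice.covolume Dt.L.lattice /
        ((cM : ℝ) ^ 2 * ((w : ℝ) / 2) ^ 2 * √|(NumberField.discr K : ℝ)|) =
      4 * B / ((cM : ℝ) ^ 2 * (w : ℝ) ^ 2) := by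
    rw [← hper]; field_simp; ring
  -- the `L`-values as real numbers
  have hLdr : Wd.entireLFunction 1 = (((qd : ℝ) * (|(u : ℝ)| * Ωt) : ℝ) : ℂ) := by
    rw [hLd, hΩd]
  have hLdne : ((qd : ℝ) * (|(u : ℝ)| * Ωt) : ℝ) ≠ 0 := by
    have hu' : |(u : ℝ)| ≠ 0 := abs_ne_zero.mpr (by exact_mod_cast huu)
    have hqd' : (qd : ℝ) ≠ 0 := by exact_mod_cast hqd0
    exact mul_ne_zero hqd' (mul_ne_zero hu' hΩt.ne')
  set X : ℝ := (4 * B / ((cM : ℝ) ^ 2 * (w : ℝ) ^ 2) * hh) / ((qd : ℝ) * (|(u : ℝ)| * Ωt))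
    with hX_def
  have hL1 : deriv W.entireLFunction 1 = ((X : ℝ) : ℂ) := by
    have hne : ((((qd : ℝ) * (|(u : ℝ)| * Ωt) : ℝ)) : ℂ) ≠ 0 := by exact_mod_cast hLdne
    have key : deriv W.entireLFunction 1 * ((((qd : ℝ) * (|(u : ℝ)| * Ωt) : ℝ)) : ℂ) =
        ((4 * B / ((cM : ℝ) ^ 2 * (w : ℝ) ^ 2) * hh : ℝ) : ℂ) := by
      rw [← hLdr, ← hLt', ← hprod, hLD, hGZc]
    rw [hX_def, Complex.ofReal_div, ← key, mul_div_cancel_right₀ _ hne]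
  have hshaAnR : shaAn W = ((X * (tW : ℝ) ^ 2 / (ΩW * (cW : ℝ) * R) : ℝ) : ℂ) := by
    rw [shaAn_def, hlead, hL1]
    push_cast
    rfl
  have hXq : X * (tW : ℝ) ^ 2 / (ΩW * (cW : ℝ) * R) = (q : ℝ) := by
    have hn' : (n : ℝ) ≠ 0 := by exact_mod_cast hn0.ne'
    have hm' : (m : ℝ) ≠ 0 := by exact_mod_cast hm0.ne'
    have htK' : (tK : ℝ) ≠ 0 := by exact_mod_cast htK.ne'
    have htW' : (tW : ℝ) ≠ 0 := by exact_mod_cast htW.ne'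
    have hcW' : (cW : ℝ) ≠ 0 := by exact_mod_cast hcW.ne'
    have hcM' : (cM : ℝ) ≠ 0 := by exact_mod_cast hc0
    have hw' : (w : ℝ) ≠ 0 := by exact_mod_cast hw.ne'
    have hu' : |(u : ℝ)| ≠ 0 := abs_ne_zero.mpr (by exact_mod_cast huu)
    have hI' : (I : ℝ) ≠ 0 := by exact_mod_cast hI0
    have hqd' : (qd : ℝ) ≠ 0 := by exact_mod_cast hqd0
    rw [hX_def, hheq, hBeq, hq_def]
    push_cast
    field_simp
    ring
  have hshaAn : shaAn W = (q : ℂ) := by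
    rw [hshaAnR, hXq]; norm_cast
  ---------------------------------------------------------------- `p`-adic valuations
  -- torsion: `v_p(tK) = v_p(tW) + v_p(td)`
  obtain ⟨θ, c, hθ, hcθ⟩ := Quadratic.exists_sq_eq_algebraMap (F := ℚ) (K := K) h2
  obtain ⟨qq, hqq, hdq⟩ := NumberField.exists_discr_eq_mul_sq h2 hθ hcθ
  have htors : padicValNat p tK = padicValNat p tW + padicValNat p td :=
    padicValNat_torsionOrder_baseChange_quadratic W K h2 hθ hcθ hqq hdq ⟨Cd, hWd⟩ p hp2
  -- `Ш`: `v_p(S_K) = v_p(S_W) + v_p(S_d)`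
  have hsha : padicValNat p (W.baseChange K).shaOrder =
      padicValNat p W.shaOrder + padicValNat p Sd := by
    have hcard := card_primaryComponent_sha_baseChange_quadratic_of_odd_of_finite W K h2 Wd
      ⟨Cd, hWd⟩ (W.baseChange K) ⟨1, one_smul _ _⟩ p hp2
    rw [WeierstrassCurve.shaOrder, WeierstrassCurve.shaOrder, hSd_def, WeierstrassCurve.shaOrder,
      ← (Nat.pow_right_injective hpp.two_le).eq_iff, pow_add,
      ← natCard_primaryComponent_eq_pow_padicValNat p, ← natCard_primaryComponent_eq_pow_padicValNat p,
      ← natCard_primaryComponent_eq_pow_padicValNat p]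
    exact hcard
  have hshaW : Nat.card (AddCommGroup.primaryComponent W.sha p) = p ^ padicValNat p W.shaOrder :=
    natCard_primaryComponent_eq_pow_padicValNat p
  -- valuation of `q`
  have hI' : (I : ℚ) ≠ 0 := by exact_mod_cast hI0
  have htW' : (tW : ℚ) ≠ 0 := by exact_mod_cast htW.ne'
  have htK' : (tK : ℚ) ≠ 0 := by exact_mod_cast htK.ne'
  have hn' : (n : ℚ) ≠ 0 := by exact_mod_cast hn0.ne'
  have hm' : (m : ℚ) ≠ 0 := by exact_mod_cast hm0.ne'
  have hcW' : (cW : ℚ) ≠ 0 := by exact_mod_cast hcW.ne'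
  have hw' : (w : ℚ) ≠ 0 := by exact_mod_cast hw.ne'
  have hua : |u| ≠ 0 := abs_ne_zero.mpr huu
  have h8 : padicValRat p (8 : ℚ) = 0 := by
    rw [show (8 : ℚ) = ((8 : ℕ) : ℚ) by norm_num, padicValRat.of_nat]
    have : ¬ p ∣ 8 := by
      intro h
      have h' : p ∣ 2 ^ 3 := by simpa using h
      exact hp2 ((Nat.prime_dvd_prime_iff_eq hpp Nat.prime_two).mp (hpp.dvd_of_dvd_pow h'))
    simp [padicValNat.eq_zero_of_not_dvd this]
  have hvn : padicValRat p (n : ℚ) = 0 := by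
    rw [padicValRat.of_nat]
    have : ¬ p ∣ n := by
      rcases hn with h' | h'
      · rw [h']; exact hpp.one_lt.ne' ∘ Nat.dvd_one.mp
      · rw [h']; intro hd; exact hp2 ((Nat.prime_dvd_prime_iff_eq hpp Nat.prime_two).mp hd)
    simp [padicValNat.eq_zero_of_not_dvd this]
  have hvm : padicValRat p (m : ℚ) = 0 := by
    rw [padicValRat.of_nat]
    have : ¬ p ∣ m := by
      rcases hm with rfl | rfl
      · exact hpp.one_lt.ne' ∘ Nat.dvd_one.mp
      · intro hd
        have h' : p ∣ 2 ^ 2 := by simpa using hd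
        exact hp2 ((Nat.prime_dvd_prime_iff_eq hpp Nat.prime_two).mp (hpp.dvd_of_dvd_pow h'))
    simp [padicValNat.eq_zero_of_not_dvd this]
  have hvc : padicValRat p (cM : ℚ) = ((padicValInt p cM : ℕ) : ℤ) := by
    rw [padicValRat.of_int]
  have hvw : padicValRat p (w : ℚ) = 0 := by
    rw [padicValRat.of_nat, padicValNat.eq_zero_of_not_dvd hμ]; rfl
  have hvu : padicValRat p |u| = 0 := by
    rcases abs_choice u with h' | h'
    · rw [h']; exact hu
    · rw [h', padicValRat.neg]; exact hu
  have hvtd : padicValNat p Wd.torsionOrder = padicValNat p td := by rw [htdeq]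
  have hval : padicValRat p q = padicValNat p (Nat.card (AddCommGroup.primaryComponent W.sha p)) := by
    -- nonvanishing of the partial products
    have hA1 : (8 : ℚ) * (I : ℚ) ^ 2 ≠ 0 := mul_ne_zero (by norm_num) (pow_ne_zero _ hI')
    have hA2 : (8 : ℚ) * (I : ℚ) ^ 2 * (tW : ℚ) ^ 2 ≠ 0 := mul_ne_zero hA1 (pow_ne_zero _ htW')
    have hD1 : (n : ℚ) * (m : ℚ) ≠ 0 := mul_ne_zero hn' hm'
    have hD2 : (n : ℚ) * (m : ℚ) * (tK : ℚ) ^ 2 ≠ 0 := mul_ne_zero hD1 (pow_ne_zero _ htK')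
    have hD3 : (n : ℚ) * (m : ℚ) * (tK : ℚ) ^ 2 * (cM : ℚ) ^ 2 ≠ 0 :=
      mul_ne_zero hD2 (pow_ne_zero _ hcM)
    have hD4 : (n : ℚ) * (m : ℚ) * (tK : ℚ) ^ 2 * (cM : ℚ) ^ 2 * (w : ℚ) ^ 2 ≠ 0 :=
      mul_ne_zero hD3 (pow_ne_zero _ hw')
    have hD5 : (n : ℚ) * (m : ℚ) * (tK : ℚ) ^ 2 * (cM : ℚ) ^ 2 * (w : ℚ) ^ 2 * qd ≠ 0 :=
      mul_ne_zero hD4 hqd0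
    have hD6 : (n : ℚ) * (m : ℚ) * (tK : ℚ) ^ 2 * (cM : ℚ) ^ 2 * (w : ℚ) ^ 2 * qd * |u| ≠ 0 :=
      mul_ne_zero hD5 hua
    have hD7 : (n : ℚ) * (m : ℚ) * (tK : ℚ) ^ 2 * (cM : ℚ) ^ 2 * (w : ℚ) ^ 2 * qd * |u| *
        (cW : ℚ) ≠ 0 := mul_ne_zero hD6 hcW'
    have hnum : padicValRat p ((8 : ℚ) * (I : ℚ) ^ 2 * (tW : ℚ) ^ 2) =
        2 * padicValNat p I + 2 * padicValNat p tW := by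
      rw [padicValRat.mul hA1 (pow_ne_zero _ htW'), padicValRat.mul (by norm_num) (pow_ne_zero _ hI'),
        padicValRat.pow, padicValRat.pow, h8, padicValRat.of_nat, padicValRat.of_nat]
      push_cast; ring
    have hden : padicValRat p ((n : ℚ) * (m : ℚ) * (tK : ℚ) ^ 2 * (cM : ℚ) ^ 2 * (w : ℚ) ^ 2 *
        qd * |u| * (cW : ℚ)) =
        2 * padicValNat p tK + 2 * padicValInt p cM + padicValRat p qd + padicValNat p cW := by
      rw [padicValRat.mul hD6 hcW', padicValRat.mul hD5 hua, padicValRat.mul hD4 hqd0,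
        padicValRat.mul hD3 (pow_ne_zero _ hw'), padicValRat.mul hD2 (pow_ne_zero _ hcM),
        padicValRat.mul hD1 (pow_ne_zero _ htK'), padicValRat.mul hn' hm', padicValRat.pow,
        padicValRat.pow, padicValRat.pow, hvn, hvm, hvc, hvw, hvu, padicValRat.of_nat,
        padicValRat.of_nat]
      push_cast; ring
    rw [hshaW, padicValNat.prime_pow, hq_def, padicValRat.div hA2 hD7, hnum, hden, hvqd, hvtd]
    have e1 := hKL
    have e2 := htors
    have e3 := hsha
    have e4 := htam
    omega
  refine ⟨by rw [hrQ, hr], inferInstance, q, hshaAn, hval⟩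

/-- **ROUTE U's use of (†): `BSD(E,p)` from `ord_p [E(K):ℤP] = ord_p c` (`hI`; for `49a1^{(D)}` at
`p = 7`: Kriz–Li 2019 Thm. 7.1 gives `ord₇ log_{ω_𝓔} P = ord₇ c` and the descent gives generator level
`0`, memo ROUTE-U Thm. U (iv)), `p ∤ ∏_ℓ c_ℓ(E/ℚ)` (`htamW`) and the triviality of the `p`-parts of
`Ш(E/ℚ)`, `Ш(E^{d_K}/ℚ)` (`hSW`, `hSd`; memo Prop. D).** (†) is assembled from these via
`Ш(E/K)[p^∞] ≅ Ш(E/ℚ)[p^∞] ⊕ Ш(E^{d_K}/ℚ)[p^∞]` (odd `p`): both sides read `2·ord_p c` — the constant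
CANCELS, no hypothesis on the Manin constant. [cite: KrizLi2019, Thm. 7.1, Rem. 3.10 and §10.3]
[cite: JetchevSkinnerWan2017, §7.4.1 (eq:gz for K′), p. 30] [cite: Miller2011LMS, Def. 1.1] -/
theorem bsdp_of_heegnerIndexVal_eq_maninVal
    (W : WeierstrassCurve ℚ) [W.IsElliptic] [W.IsGloballyMinimal] (p : ℕ) [Fact p.Prime]
    (N : ℕ) [NeZero N] (K : Type) [Field K] [NumberField K]
    (Dt : ModularParametrizationData W N) (H : HeegnerDatum N (NumberField.discr K)) (ι : K →+* ℂ)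
    (P : (W.baseChange K).toAffine.Point)
    (hGZ : gross_zagier N W K) (hKo : kolyvagin N W K)
    (hGZK : rank_eq_analyticRank_of_analyticRank_le_one) (hmod : hasEntireLFunction_rat)
    (hK : IsImaginaryQuadratic K) (hHN : SatisfiesHeegnerHypothesis N K)
    (hP : WeierstrassCurve.Affine.Point.map ι.toRatAlgHom P = heegnerPointComplex Dt H)
    (hp2 : p ≠ 2) (hc0 : Dt.c ≠ 0) (hμ : ¬ p ∣ Units.torsionOrder K)
    (hr : W.analyticRank = 1)
    (hLt : (W.quadraticTwist (NumberField.discr K : ℚ)).entireLFunction 1 ≠ 0)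
    (Wd : WeierstrassCurve ℚ) [Wd.IsElliptic] [Wd.IsGloballyMinimal] (Cd : VariableChange ℚ)
    (hWd : Cd • W.quadraticTwist (NumberField.discr K : ℚ) = Wd)
    (htw : ∃ q : ℚ, Wd.entireLFunction 1 / (Wd.realPeriodRat : ℂ) = (q : ℂ) ∧
      padicValRat p q = (padicValNat p Wd.shaOrder : ℤ) + padicValNat p Wd.tamagawaProduct -
        2 * padicValNat p Wd.torsionOrder)
    (htam : padicValNat p Wd.tamagawaProduct = padicValNat p W.tamagawaProduct)
    (hu : padicValRat p (Cd.u : ℚ) = 0)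
    -- the four Route-U inputs
    (hI : padicValNat p (AddSubgroup.zmultiples P).index = padicValInt p Dt.c)
    (htamW : ¬ p ∣ W.tamagawaProduct)
    (hSW : ∀ [Finite W.sha], ¬ p ∣ W.shaOrder) (hSd : ∀ [Finite Wd.sha], ¬ p ∣ Wd.shaOrder) :
    BSDp W p := by
  have hpp : p.Prime := Fact.out
  refine bsdp_of_indexIdentityManin W p N K Dt H ι P hGZ hKo hGZK hmod hK hHN hP hp2 hc0 hμ hr hLt Wd
    Cd hWd htw htam hu (fun hfinK => ?_)
  obtain ⟨h2, hKtc⟩ := hK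
  haveI : Finite (W.baseChange K).sha := hfinK
  haveI hfinW : Finite W.sha :=
    Literature.NumberTheory.EllipticCurves.shaFinite_of_baseChange W K hfinK
  have hD0 : (NumberField.discr K : ℚ) ≠ 0 := by exact_mod_cast NumberField.discr_ne_zero K
  haveI hEt : (W.quadraticTwist (NumberField.discr K : ℚ)).IsElliptic :=
    W.isElliptic_quadraticTwist hD0
  have hrt : (W.quadraticTwist (NumberField.discr K : ℚ)).analyticRank = 0 :=
    ((W.quadraticTwist _).analyticRank_eq_zero_iff_holds (hmod _)).2 hLt
  have hrd : Wd.analyticRank = 0 := by rw [← hWd, analyticRank_smul, hrt]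
  obtain ⟨-, hShad⟩ := hGZK Wd (by omega)
  haveI hfinSd : Finite Wd.sha := hShad
  have hsha : padicValNat p (W.baseChange K).shaOrder =
      padicValNat p W.shaOrder + padicValNat p Wd.shaOrder := by
    have hcard := card_primaryComponent_sha_baseChange_quadratic_of_odd_of_finite W K h2 Wd
      ⟨Cd, hWd⟩ (W.baseChange K) ⟨1, one_smul _ _⟩ p hp2
    rw [WeierstrassCurve.shaOrder, WeierstrassCurve.shaOrder, WeierstrassCurve.shaOrder,
      ← (Nat.pow_right_injective hpp.two_le).eq_iff, pow_add,
      ← natCard_primaryComponent_eq_pow_padicValNat p, ← natCard_primaryComponent_eq_pow_padicValNat p,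
      ← natCard_primaryComponent_eq_pow_padicValNat p]
    exact hcard
  have h1 : padicValNat p W.shaOrder = 0 := padicValNat.eq_zero_of_not_dvd hSW
  have h2' : padicValNat p Wd.shaOrder = 0 := padicValNat.eq_zero_of_not_dvd hSd
  have h3 : padicValNat p W.tamagawaProduct = 0 := padicValNat.eq_zero_of_not_dvd htamW
  rw [hsha, h1, h2', h3, hI]
  ring

end Summit.BirchSwinnertonDyer.Rank1Residual.X12.O11

end
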